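import Summits.AnomalousDissipation.AnomalousDissipation.Theorems.MarginalStabilityChainChainRealisationStubLiftBoundsA
import Summits.AnomalousDissipation.AnomalousDissipation.Theorems.MarginalStabilityChainChainRealisationStubLiftBoundsB
import Literature.Analysis.FluidPDE.TorusWordEnergy
import HarnessLib

/-!
# Stub `stub_liftBounds` of the line `SketchIdeator2` (card `separatrix-flux-pinning`), part C:
# time derivatives of a forward classical solution in Sobolev currency
# (crux stmt-AnomalousDissipation-14249, `MarginalStabilityChain.ChainRealisation`)

For a forward classical Navier–Stokes solution `(u, p)` on `[0, ∞) × T³` with a steady smooth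
force `F` and `sup_{t ≥ 0} E_k(u(t)) < ∞` for every `k` (`E_k = Torus.sobolevEnergy k`), all time
derivatives `∂ₜʲ u` are bounded in every `E_k`, uniformly in `t ≥ 0`
(`liftB_sobolev_allorders`), hence all `∂^w ∂ₜʲ u` and all `∂^w ∇∂ₜʲ p` are bounded on
`[0, ∞) × T³` (`liftB_sup_words_velocity`, `liftB_sup_words_pressure_grad`).

Proof (Foias–Manley–Rosa–Temam 2001, Ch. II §A.5; Constantin–Foias 1988, Ch. 13), WITHOUT
multiplier theory: differentiating the momentum equation `j` times in time
(`liftB_momentum_iter`: `∂ₜʲ⁺¹u = νΔ∂ₜʲu − ∑ (∂ₜᵃu·∇)∂ₜᵇu − ∇∂ₜʲp + [j = 0] F`, a Leibniz sum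
with `a, b ≤ j`), the field `∂^w∂ₜʲ⁺¹u` is smooth and solenoidal, hence `L²`-orthogonal to the
gradient `∂^w∇∂ₜʲp = ∇∂^w∂ₜʲp`, so that `‖∂^w∂ₜʲ⁺¹u‖₂ ≤ ‖∂^w(νΔ∂ₜʲu − ∑(∂ₜᵃu·∇)∂ₜᵇu + [j=0]F)‖₂`
(`liftB_word_energy_ineq`); the right-hand side is controlled by the Sobolev energies of the
`∂ₜⁱu`, `i ≤ j` (the Laplacian costs two letters, the convective words are bounded by
sup × `L²`, part B), and induction on `j` closes.

References: C. Foias, O. Manley, R. Rosa, R. Temam, *Navier–Stokes Equations and Turbulence*,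
CUP 2001, Ch. II App. A §A.5; P. Constantin, C. Foias, *Navier–Stokes Equations*, Univ. Chicago
Press 1988, Ch. 13.
-/

-- `Summit.<Summit>.<Problem>` is the tree's mandated summit-side namespace (CONVENTIONS §2); for this
-- single-conjunct summit the two coincide, so the duplicate is deliberate.
set_option linter.dupNamespace false

noncomputable section

open MeasureTheory Set Filter Topology Function
open scoped InnerProductSpace
open Literature.Analysis.FunctionSpaces Literature.Analysis.FunctionSpaces.Torus
open Literature.Analysis.FluidPDE.Torus

namespace Summit.AnomalousDissipation.AnomalousDissipation.Theorems.ChainRealisation.SeparatrixFluxPinning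

variable {ν : ℝ} {F : UnitAddTorus (Fin 3) → EuclideanSpace ℝ (Fin 3)}
  {u : ℝ → UnitAddTorus (Fin 3) → EuclideanSpace ℝ (Fin 3)} {p : ℝ → UnitAddTorus (Fin 3) → ℝ}

/-! ## The momentum equation differentiated `j` times in time -/

/-- **`∂ₜʲ⁺¹u = νΔ∂ₜʲu − ∑ₖ (∂ₜ^{aₖ}u·∇)∂ₜ^{bₖ}u − ∇∂ₜʲp + [j = 0] F` on `[0, ∞) × T³`**, the
momentum equation differentiated `j` times in time; the convective part is a finite Leibniz sum
with `aₖ, bₖ ≤ j`. -/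
theorem liftB_momentum_iter (hsol : IsClassicalNSSolutionOn (Ici 0) ν (fun _ => F) u p)
    (hF : IsSmooth F) :
    ∀ j : ℕ, ∃ (ι : Type) (_ : Fintype ι) (α β : ι → ℕ), (∀ k, α k ≤ j) ∧ (∀ k, β k ≤ j) ∧
      ∀ t ∈ Ici (0 : ℝ), ∀ x : UnitAddTorus (Fin 3),
        ((timeDerivWithin (Ici 0))^[j + 1] u) t x = ν • laplacian (((timeDerivWithin (Ici 0))^[j] u) t) x
          - (∑ k, convect (((timeDerivWithin (Ici 0))^[α k] u) t) (((timeDerivWithin (Ici 0))^[β k] u) t) x)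
          - gradient (((timeDerivWithin (Ici 0))^[j] p) t) x + (if j = 0 then F x else 0)
  | 0 => by
      refine ⟨Unit, inferInstance, fun _ => 0, fun _ => 0, fun _ => le_rfl, fun _ => le_rfl,
        fun t ht x => ?_⟩
      have h := hsol.momentum t ht x
      simp only [iterate_zero, id_eq, Finset.univ_unique, Finset.sum_singleton, if_true]
      show timeDerivWithin (Ici 0) u t x = _
      rw [eq_sub_of_add_eq h]
      abel
  | j + 1 => by
      obtain ⟨ι, _, α, β, hα, hβ, hj⟩ := liftB_momentum_iter hsol hF j
      refine ⟨ι ⊕ ι, inferInstance, Sum.elim (fun k => α k + 1) α, Sum.elim β (fun k => β k + 1),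
        ?_, ?_, fun t ht x => ?_⟩
      · rintro (k | k)
        · simpa using hα k
        · simpa using (hα k).trans (Nat.le_succ j)
      · rintro (k | k)
        · simpa using (hβ k).trans (Nat.le_succ j)
        · simpa using hβ k
      have hS := uniqueDiffOn_Ici (0 : ℝ)
      have hU : ∀ i, IsSmoothSpaceTimeOn (Ici 0) ((timeDerivWithin (Ici 0))^[i] u) := fun i =>
        hsol.smooth_velocity.iterate_timeDerivWithin hS i
      have hP : ∀ i, IsSmoothSpaceTimeOn (Ici 0) ((timeDerivWithin (Ici 0))^[i] p) := fun i =>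
        hsol.smooth_pressure.iterate_timeDerivWithin hS i
      -- the right-hand side at step `j`, as a space–time field
      set R : ℝ → UnitAddTorus (Fin 3) → EuclideanSpace ℝ (Fin 3) := fun s y => ν • laplacian (((timeDerivWithin (Ici 0))^[j] u) s) y
          - (∑ k, convect (((timeDerivWithin (Ici 0))^[α k] u) s) (((timeDerivWithin (Ici 0))^[β k] u) s) y)
          - gradient (((timeDerivWithin (Ici 0))^[j] p) s) y + (if j = 0 then F y else 0) with hR
      have e1 : ((timeDerivWithin (Ici 0))^[j + 1 + 1] u) t x = timeDerivWithin (Ici 0) R t x := by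
        rw [iterate_succ_apply']
        exact liftB_T_congr (fun s hs y => hj s hs y) ht x
      -- the time derivative of each term of `R`
      have hfold_u : ∀ i, timeDerivWithin (Ici 0) ((timeDerivWithin (Ici 0))^[i] u) = (timeDerivWithin (Ici 0))^[i + 1] u := fun i => (iterate_succ_apply' _ i u).symm
      have hfold_p : ∀ i, timeDerivWithin (Ici 0) ((timeDerivWithin (Ici 0))^[i] p) = (timeDerivWithin (Ici 0))^[i + 1] p := fun i => (iterate_succ_apply' _ i p).symm
      have hA : HasDerivWithinAt (fun s => laplacian (((timeDerivWithin (Ici 0))^[j] u) s) x)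
          (laplacian (((timeDerivWithin (Ici 0))^[j + 1] u) t) x) (Ici 0) t := by
        refine (((hU j).laplacian hS).hasDerivWithinAt_slice ht x).congr_deriv ?_
        rw [liftB_T_laplacian_comm (hU j) ht x, hfold_u]
      have hB : HasDerivWithinAt (fun s => ∑ k, convect (((timeDerivWithin (Ici 0))^[α k] u) s) (((timeDerivWithin (Ici 0))^[β k] u) s) x)
          (∑ k : ι ⊕ ι, convect (((timeDerivWithin (Ici 0))^[Sum.elim (fun k => α k + 1) α k] u) t)
            (((timeDerivWithin (Ici 0))^[Sum.elim β (fun k => β k + 1) k] u) t) x) (Ici 0) t := by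
        have hN : IsSmoothSpaceTimeOn (Ici 0)
            (fun s y => ∑ k, convect (((timeDerivWithin (Ici 0))^[α k] u) s) (((timeDerivWithin (Ici 0))^[β k] u) s) y) :=
          IsSmoothSpaceTimeOn.sum fun k _ => (hU (α k)).convect (hU (β k)) hS
        refine (hN.hasDerivWithinAt_slice ht x).congr_deriv ?_
        rw [timeDerivWithin_finset_sum Finset.univ (fun k _ => (hU (α k)).convect (hU (β k)) hS) hS ht x,
          Fintype.sum_sum_type]
        simp only [Sum.elim_inl, Sum.elim_inr]
        rw [← Finset.sum_add_distrib]
        refine Finset.sum_congr rfl fun k _ => ?_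
        rw [liftB_T_convect (hU (α k)) (hU (β k)) ht x, hfold_u, hfold_u]
      have hC : HasDerivWithinAt (fun s => gradient (((timeDerivWithin (Ici 0))^[j] p) s) x)
          (gradient (((timeDerivWithin (Ici 0))^[j + 1] p) t) x) (Ici 0) t := by
        refine (((hP j).gradient hS).hasDerivWithinAt_slice ht x).congr_deriv ?_
        rw [liftB_T_gradient_comm (hP j) ht x, hfold_p]
      have hD : HasDerivWithinAt (fun _ : ℝ => (if j = 0 then F x else 0 : EuclideanSpace ℝ (Fin 3))) 0 (Ici 0) t :=
        hasDerivWithinAt_const t _ _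
      have key := (((hA.const_smul ν).sub hB).sub hC).add hD
      have e2 : timeDerivWithin (Ici 0) R t x = ν • laplacian (((timeDerivWithin (Ici 0))^[j + 1] u) t) x
          - (∑ k : ι ⊕ ι, convect (((timeDerivWithin (Ici 0))^[Sum.elim (fun k => α k + 1) α k] u) t)
              (((timeDerivWithin (Ici 0))^[Sum.elim β (fun k => β k + 1) k] u) t) x)
          - gradient (((timeDerivWithin (Ici 0))^[j + 1] p) t) x + 0 :=
        key.derivWithin (hS t ht)
      rw [e1, e2]
      simp

/-! ## The pressure-free word inequality for `∂ₜʲ⁺¹u` -/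

/-- **`‖∂^w∂ₜʲ⁺¹u‖₂ ≤ ‖∂^w(νΔ∂ₜʲu − ∑(∂ₜᵃu·∇)∂ₜᵇu + [j = 0]F)‖₂`**: `∂^w∂ₜʲ⁺¹u` is smooth and
solenoidal, so the pressure gradient `∂^w∇∂ₜʲp = ∇∂^w∂ₜʲp` is `L²`-orthogonal to it. -/
theorem liftB_word_energy_ineq (hsol : IsClassicalNSSolutionOn (Ici 0) ν (fun _ => F) u p)
    (hF : IsSmooth F) (j : ℕ) :
    ∃ (ι : Type) (_ : Fintype ι) (α β : ι → ℕ), (∀ k, α k ≤ j) ∧ (∀ k, β k ≤ j) ∧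
      ∀ (w : List (Fin 3)), ∀ t ∈ Ici (0 : ℝ),
        ∫ x, ‖wordDeriv w (((timeDerivWithin (Ici 0))^[j + 1] u) t) x‖ ^ 2 ≤
          ∫ x, ‖wordDeriv w (fun y => ν • laplacian (((timeDerivWithin (Ici 0))^[j] u) t) y
            - (∑ k, convect (((timeDerivWithin (Ici 0))^[α k] u) t) (((timeDerivWithin (Ici 0))^[β k] u) t) y)
            + (if j = 0 then F y else 0)) x‖ ^ 2 := by
  obtain ⟨ι, _, α, β, hα, hβ, hj⟩ := liftB_momentum_iter hsol hF j
  refine ⟨ι, inferInstance, α, β, hα, hβ, fun w t ht => ?_⟩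
  have hS := uniqueDiffOn_Ici (0 : ℝ)
  have hU : ∀ i, IsSmoothSpaceTimeOn (Ici 0) ((timeDerivWithin (Ici 0))^[i] u) := fun i =>
    hsol.smooth_velocity.iterate_timeDerivWithin hS i
  have hUt : ∀ i, IsSmooth (((timeDerivWithin (Ici 0))^[i] u) t) := fun i => (hU i).isSmooth_slice ht
  have hPt : IsSmooth (((timeDerivWithin (Ici 0))^[j] p) t) :=
    (hsol.smooth_pressure.iterate_timeDerivWithin hS j).isSmooth_slice ht
  have hcF : IsSmooth (fun y : UnitAddTorus (Fin 3) => (if j = 0 then F y else 0 : EuclideanSpace ℝ (Fin 3))) := by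
    split_ifs
    · exact hF
    · exact isSmooth_const _
  -- the pressure-free right-hand side `B` and its smoothness
  set B : UnitAddTorus (Fin 3) → EuclideanSpace ℝ (Fin 3) := fun y => ν • laplacian (((timeDerivWithin (Ici 0))^[j] u) t) y
      - (∑ k, convect (((timeDerivWithin (Ici 0))^[α k] u) t) (((timeDerivWithin (Ici 0))^[β k] u) t) y) + (if j = 0 then F y else 0) with hB_def
  have hN : IsSmooth (fun y : UnitAddTorus (Fin 3) => ∑ k, convect (((timeDerivWithin (Ici 0))^[α k] u) t) (((timeDerivWithin (Ici 0))^[β k] u) t) y) :=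
    ContDiff.sum fun k _ => (hUt (α k)).convect (hUt (β k))
  have hBs : IsSmooth B := (((hUt j).laplacian.smul ν).sub hN).add hcF
  -- `∂ₜʲ⁺¹u(t) = B - ∇∂ₜʲp(t)` as functions on `T³`
  have hfun : ((timeDerivWithin (Ici 0))^[j + 1] u) t = B - gradient (((timeDerivWithin (Ici 0))^[j] p) t) := by
    funext y
    rw [hj t ht y]
    simp only [hB_def, Pi.sub_apply]
    abel
  refine liftB_integral_norm_sq_le_of_eq_sub_gradient (isSmooth_wordDeriv (hUt (j + 1)) w)
    (isSmooth_wordDeriv hBs w) (isSmooth_wordDeriv hPt w)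
    (liftB_isDivFree_wordDeriv (hUt (j + 1))
      (liftB_Titer_isDivFree hsol.smooth_velocity hsol.divFree (j + 1) ht) w) fun x => ?_
  rw [hfun, wordDeriv_sub hBs hPt.gradient w, Pi.sub_apply, liftB_wordDeriv_gradient_comm hPt w]

/-! ## All-order Sobolev bounds of the time derivatives -/

/-- **All time derivatives of `u` are bounded in every `H^k`, uniformly on `t ≥ 0`** (given the
all-order bounds of `u` itself): `∀ j k, ∃ C, ∀ i ≤ j, ∀ t ≥ 0, E_k(∂ₜⁱu(t)) ≤ C`. -/
theorem liftB_sobolev_allorders (hsol : IsClassicalNSSolutionOn (Ici 0) ν (fun _ => F) u p)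
    (hF : IsSmooth F) (h0 : ∀ k : ℕ, ∃ C : ℝ, ∀ t : ℝ, 0 ≤ t → sobolevEnergy k (u t) ≤ C) :
    ∀ j k : ℕ, ∃ C : ℝ, ∀ i ≤ j, ∀ t ∈ Ici (0 : ℝ), sobolevEnergy k (((timeDerivWithin (Ici 0))^[i] u) t) ≤ C
  | 0, k => by
      obtain ⟨C, hC⟩ := h0 k
      exact ⟨C, fun i hi t ht => by rw [Nat.le_zero.1 hi]; exact hC t ht⟩
  | j + 1, k => by
      have IH := fun k' => liftB_sobolev_allorders hsol hF h0 j k'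
      have hS := uniqueDiffOn_Ici (0 : ℝ)
      have hU : ∀ i, IsSmoothSpaceTimeOn (Ici 0) ((timeDerivWithin (Ici 0))^[i] u) := fun i =>
        hsol.smooth_velocity.iterate_timeDerivWithin hS i
      obtain ⟨ι, _, α, β, hα, hβ, hineq⟩ := liftB_word_energy_ineq hsol hF j
      obtain ⟨Kc, hKc, hconv⟩ := liftB_exists_convect_word_sq (EuclideanSpace ℝ (Fin 3))
      have ci : ∀ {g : UnitAddTorus (Fin 3) → ℝ}, Continuous g → Integrable g volume := fun hg =>
        hg.integrable_of_hasCompactSupport (HasCompactSupport.of_compactSpace _)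
      -- per-word bound of `∂^w ∂ₜʲ⁺¹ u`
      have hw : ∀ w : List (Fin 3), ∃ C : ℝ, ∀ t ∈ Ici (0 : ℝ),
          ∫ x, ‖wordDeriv w (((timeDerivWithin (Ici 0))^[j + 1] u) t) x‖ ^ 2 ≤ C := by
        intro w
        obtain ⟨A, hA⟩ := IH (w.length + 2)
        set CF : ℝ := ∫ x, ‖wordDeriv w F x‖ ^ 2 with hCF
        have hCF0 : 0 ≤ CF := integral_nonneg fun _ => sq_nonneg _
        refine ⟨3 * (ν ^ 2 * (9 * A) + (Fintype.card ι) * ((Fintype.card ι) *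
          (Kc * 4 ^ w.length * A * A)) + CF), fun t ht => (hineq w t ht).trans ?_⟩
        have hUt : ∀ i, IsSmooth (((timeDerivWithin (Ici 0))^[i] u) t) := fun i => (hU i).isSmooth_slice ht
        have hA0 : 0 ≤ A := (sobolevEnergy_nonneg _ _).trans (hA j le_rfl t ht)
        -- the three pieces
        set L : UnitAddTorus (Fin 3) → EuclideanSpace ℝ (Fin 3) := laplacian (((timeDerivWithin (Ici 0))^[j] u) t) with hL
        set N : UnitAddTorus (Fin 3) → EuclideanSpace ℝ (Fin 3) := fun y => ∑ k, convect (((timeDerivWithin (Ici 0))^[α k] u) t) (((timeDerivWithin (Ici 0))^[β k] u) t) y with hN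
        set c : UnitAddTorus (Fin 3) → EuclideanSpace ℝ (Fin 3) := fun y => if j = 0 then F y else 0 with hc
        have hLs : IsSmooth L := (hUt j).laplacian
        have hNs : IsSmooth N := ContDiff.sum fun k _ => (hUt (α k)).convect (hUt (β k))
        have hcs : IsSmooth c := by
          rw [hc]
          split_ifs
          · exact hF
          · exact isSmooth_const _
        have hsplit : wordDeriv w (fun y => ν • L y
            - (∑ k, convect (((timeDerivWithin (Ici 0))^[α k] u) t) (((timeDerivWithin (Ici 0))^[β k] u) t) y) + (if j = 0 then F y else 0)) =
            fun y => ν • wordDeriv w L y - wordDeriv w N y + wordDeriv w c y := by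
          have e : (fun y => ν • L y
              - (∑ k, convect (((timeDerivWithin (Ici 0))^[α k] u) t) (((timeDerivWithin (Ici 0))^[β k] u) t) y) + (if j = 0 then F y else 0)) =
              ν • L - N + c := rfl
          rw [e, wordDeriv_add ((hLs.smul ν).sub hNs) hcs w, wordDeriv_sub (hLs.smul ν) hNs w,
            wordDeriv_const_smul hLs ν w]
          rfl
        -- `L²` bounds of the pieces
        have h1 : ∫ x, ‖wordDeriv w L x‖ ^ 2 ≤ 9 * A :=
          (liftB_integral_norm_sq_wordDeriv_laplacian_le (hUt j) w).trans
            (mul_le_mul_of_nonneg_left ((wordEnergy_le_sobolevEnergy le_rfl _).trans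
              (hA j le_rfl t ht)) (by norm_num))
        have h2 : ∫ x, ‖wordDeriv w N x‖ ^ 2 ≤
            (Fintype.card ι) * ((Fintype.card ι) * (Kc * 4 ^ w.length * A * A)) := by
          rw [hN, liftB_wordDeriv_fun_sum Finset.univ (fun k _ => (hUt (α k)).convect (hUt (β k))) w]
          refine (integral_norm_sq_sum_le fun k =>
            (isSmooth_wordDeriv ((hUt (α k)).convect (hUt (β k))) w).continuous).trans ?_
          refine mul_le_mul_of_nonneg_left ?_ (Nat.cast_nonneg _)
          have hk : ∀ k : ι, ∫ x, ‖wordDeriv w (convect (((timeDerivWithin (Ici 0))^[α k] u) t) (((timeDerivWithin (Ici 0))^[β k] u) t)) x‖ ^ 2 ≤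
              Kc * 4 ^ w.length * A * A := fun k =>
            (hconv _ _ (hUt (α k)) (hUt (β k)) w).trans
              (mul_le_mul (mul_le_mul_of_nonneg_left (hA (α k) (hα k) t ht) (by positivity))
                (hA (β k) (hβ k) t ht) (sobolevEnergy_nonneg _ _) (by positivity))
          calc ∑ k, ∫ x, ‖wordDeriv w (convect (((timeDerivWithin (Ici 0))^[α k] u) t) (((timeDerivWithin (Ici 0))^[β k] u) t)) x‖ ^ 2
              ≤ ∑ _k : ι, Kc * 4 ^ w.length * A * A := Finset.sum_le_sum fun k _ => hk k
            _ = (Fintype.card ι) * (Kc * 4 ^ w.length * A * A) := by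
                rw [Finset.sum_const, Finset.card_univ, nsmul_eq_mul]
        have h3 : ∫ x, ‖wordDeriv w c x‖ ^ 2 ≤ CF := by
          rw [hc]
          by_cases hj0 : j = 0
          · simp only [hj0, if_true]
            exact le_rfl
          · simp only [hj0, if_false]
            rw [wordDeriv_zero]
            simpa using hCF0
        -- assemble
        rw [hsplit]
        have iL : Integrable (fun x => ‖wordDeriv w L x‖ ^ 2) volume :=
          ci ((isSmooth_wordDeriv hLs w).continuous.norm.pow 2)
        have iN : Integrable (fun x => ‖wordDeriv w N x‖ ^ 2) volume :=
          ci ((isSmooth_wordDeriv hNs w).continuous.norm.pow 2)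
        have ic : Integrable (fun x => ‖wordDeriv w c x‖ ^ 2) volume :=
          ci ((isSmooth_wordDeriv hcs w).continuous.norm.pow 2)
        calc ∫ x, ‖ν • wordDeriv w L x - wordDeriv w N x + wordDeriv w c x‖ ^ 2
            ≤ ∫ x, 3 * (ν ^ 2 * ‖wordDeriv w L x‖ ^ 2 + ‖wordDeriv w N x‖ ^ 2 +
                ‖wordDeriv w c x‖ ^ 2) := by
              refine integral_mono ?_ ((((iL.const_mul _).add iN).add ic).const_mul 3)
                fun x => liftB_norm_sq_three_le ν _ _ _
              exact ci (((((isSmooth_wordDeriv hLs w).smul ν).sub (isSmooth_wordDeriv hNs w)).add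
                (isSmooth_wordDeriv hcs w)).continuous.norm.pow 2)
          _ = 3 * (ν ^ 2 * (∫ x, ‖wordDeriv w L x‖ ^ 2) + (∫ x, ‖wordDeriv w N x‖ ^ 2) +
                ∫ x, ‖wordDeriv w c x‖ ^ 2) := by
              have iνL : Integrable (fun x => ν ^ 2 * ‖wordDeriv w L x‖ ^ 2) volume :=
                iL.const_mul _
              have iLN : Integrable (fun x => ν ^ 2 * ‖wordDeriv w L x‖ ^ 2 +
                  ‖wordDeriv w N x‖ ^ 2) volume := iνL.add iN
              rw [integral_const_mul, integral_add iLN ic, integral_add iνL iN, integral_const_mul]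
          _ ≤ 3 * (ν ^ 2 * (9 * A) + (Fintype.card ι) * ((Fintype.card ι) *
                (Kc * 4 ^ w.length * A * A)) + CF) := by
              gcongr
      -- sum over the words of length `≤ k`
      choose Cw hCw using hw
      obtain ⟨C0, hC0⟩ := IH k
      refine ⟨max C0 (∑ n ∈ Finset.range (k + 1), ∑ v : Fin n → Fin 3, Cw (List.ofFn v)),
        fun i hi t ht => ?_⟩
      rcases Nat.lt_or_ge i (j + 1) with hlt | hge
      · exact (hC0 i (Nat.lt_succ_iff.1 hlt) t ht).trans (le_max_left _ _)
      · have hi' : i = j + 1 := le_antisymm hi hge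
        subst hi'
        refine le_trans ?_ (le_max_right _ _)
        exact Finset.sum_le_sum fun n _ => Finset.sum_le_sum fun v _ => hCw _ t ht

/-! ## Sup bounds of all `∂^w ∂ₜʲ u` and of all `∂^w ∇∂ₜʲ p` -/

/-- **Every `∂^w ∂ₜʲ u` is bounded on `[0, ∞) × T³`.** -/
theorem liftB_sup_words_velocity (hsol : IsClassicalNSSolutionOn (Ici 0) ν (fun _ => F) u p)
    (hF : IsSmooth F) (h0 : ∀ k : ℕ, ∃ C : ℝ, ∀ t : ℝ, 0 ≤ t → sobolevEnergy k (u t) ≤ C)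
    (j : ℕ) (w : List (Fin 3)) :
    ∃ C : ℝ, ∀ t ∈ Ici (0 : ℝ), ∀ x : UnitAddTorus (Fin 3), ‖wordDeriv w (((timeDerivWithin (Ici 0))^[j] u) t) x‖ ≤ C := by
  obtain ⟨K, hK, hsup⟩ := liftB_exists_norm_sq_wordDeriv_le (EuclideanSpace ℝ (Fin 3))
  obtain ⟨A, hA⟩ := liftB_sobolev_allorders hsol hF h0 j (w.length + 2)
  have hU : IsSmoothSpaceTimeOn (Ici 0) ((timeDerivWithin (Ici 0))^[j] u) :=
    hsol.smooth_velocity.iterate_timeDerivWithin (uniqueDiffOn_Ici 0) j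
  refine ⟨Real.sqrt (K * A), fun t ht x => Real.le_sqrt_of_sq_le ?_⟩
  exact (hsup _ (hU.isSmooth_slice ht) w x).trans
    (mul_le_mul_of_nonneg_left (hA j le_rfl t ht) hK.le)

/-- **Every `∂^w ∇∂ₜʲ p` is bounded on `[0, ∞) × T³`**: by the differentiated momentum equation
`∇∂ₜʲp = νΔ∂ₜʲu − ∑(∂ₜᵃu·∇)∂ₜᵇu + [j = 0]F − ∂ₜʲ⁺¹u`, every word derivative of which is bounded
(`liftB_sup_words_velocity` and the pointwise Leibniz bound of part B). -/
theorem liftB_sup_words_pressure_grad (hsol : IsClassicalNSSolutionOn (Ici 0) ν (fun _ => F) u p)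
    (hF : IsSmooth F) (h0 : ∀ k : ℕ, ∃ C : ℝ, ∀ t : ℝ, 0 ≤ t → sobolevEnergy k (u t) ≤ C)
    (j : ℕ) (w : List (Fin 3)) :
    ∃ C : ℝ, ∀ t ∈ Ici (0 : ℝ), ∀ x : UnitAddTorus (Fin 3), ‖wordDeriv w (gradient (((timeDerivWithin (Ici 0))^[j] p) t)) x‖ ≤ C := by
  have hS := uniqueDiffOn_Ici (0 : ℝ)
  have hU : ∀ i, IsSmoothSpaceTimeOn (Ici 0) ((timeDerivWithin (Ici 0))^[i] u) := fun i =>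
    hsol.smooth_velocity.iterate_timeDerivWithin hS i
  obtain ⟨ι, _, α, β, _, _, hj⟩ := liftB_momentum_iter hsol hF j
  choose Cv hCv using liftB_sup_words_velocity hsol hF h0
  -- a bound of the steady force words
  obtain ⟨CF, hCF⟩ : ∃ CF : ℝ, ∀ x : UnitAddTorus (Fin 3), ‖wordDeriv w F x‖ ≤ CF := by
    obtain ⟨C, hC⟩ := isCompact_univ.exists_bound_of_continuousOn
      ((isSmooth_wordDeriv hF w).continuous.continuousOn)
    exact ⟨C, fun x => hC x (mem_univ x)⟩
  have hCF0 : 0 ≤ CF := (norm_nonneg _).trans (hCF 0)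
  refine ⟨|ν| * (∑ i : Fin 3, Cv j (w ++ [i, i])) +
    (∑ k, ∑ k' : Fin 3, ∑ m : Fin (splits w).length,
      Cv (α k) ((splits w).get m).1 * Cv (β k) (((splits w).get m).2 ++ [k'])) +
    CF + Cv (j + 1) w, fun t ht x => ?_⟩
  have hUt : ∀ i, IsSmooth (((timeDerivWithin (Ici 0))^[i] u) t) := fun i => (hU i).isSmooth_slice ht
  set L : UnitAddTorus (Fin 3) → EuclideanSpace ℝ (Fin 3) := laplacian (((timeDerivWithin (Ici 0))^[j] u) t) with hL
  set N : UnitAddTorus (Fin 3) → EuclideanSpace ℝ (Fin 3) := fun y => ∑ k, convect (((timeDerivWithin (Ici 0))^[α k] u) t) (((timeDerivWithin (Ici 0))^[β k] u) t) y with hN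
  set c : UnitAddTorus (Fin 3) → EuclideanSpace ℝ (Fin 3) := fun y => if j = 0 then F y else 0 with hc
  have hLs : IsSmooth L := (hUt j).laplacian
  have hNs : IsSmooth N := ContDiff.sum fun k _ => (hUt (α k)).convect (hUt (β k))
  have hcs : IsSmooth c := by
    rw [hc]
    split_ifs
    · exact hF
    · exact isSmooth_const _
  -- `∇∂ₜʲp(t) = ν • L - N + c - ∂ₜʲ⁺¹u(t)` as functions
  have hfun : gradient (((timeDerivWithin (Ici 0))^[j] p) t) = ν • L - N + c - ((timeDerivWithin (Ici 0))^[j + 1] u) t := by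
    funext y
    simp only [Pi.sub_apply, Pi.add_apply, Pi.smul_apply, hj t ht y, hL, hN, hc]
    abel
  rw [hfun, wordDeriv_sub (((hLs.smul ν).sub hNs).add hcs) (hUt (j + 1)) w,
    wordDeriv_add ((hLs.smul ν).sub hNs) hcs w, wordDeriv_sub (hLs.smul ν) hNs w,
    wordDeriv_const_smul hLs ν w]
  simp only [Pi.sub_apply, Pi.add_apply, Pi.smul_apply]
  -- bound each piece
  have b1 : ‖ν • wordDeriv w L x‖ ≤ |ν| * ∑ i : Fin 3, Cv j (w ++ [i, i]) := by
    rw [norm_smul, Real.norm_eq_abs]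
    refine mul_le_mul_of_nonneg_left ?_ (abs_nonneg ν)
    rw [hL, liftB_wordDeriv_laplacian (hUt j) w]
    exact (norm_sum_le _ _).trans (Finset.sum_le_sum fun i _ => hCv j _ t ht x)
  have b2 : ‖wordDeriv w N x‖ ≤ ∑ k, ∑ k' : Fin 3, ∑ m : Fin (splits w).length,
      Cv (α k) ((splits w).get m).1 * Cv (β k) (((splits w).get m).2 ++ [k']) := by
    rw [hN, liftB_wordDeriv_fun_sum Finset.univ (fun k _ => (hUt (α k)).convect (hUt (β k))) w]
    refine (norm_sum_le _ _).trans (Finset.sum_le_sum fun k _ => ?_)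
    refine (liftB_norm_wordDeriv_convect_le (hUt (α k)) (hUt (β k)) w x).trans
      (Finset.sum_le_sum fun k' _ => Finset.sum_le_sum fun m _ => ?_)
    have ha : |wordDeriv ((splits w).get m).1 (fun y => ((timeDerivWithin (Ici 0))^[α k] u) t y k') x| ≤
        Cv (α k) ((splits w).get m).1 := by
      rw [← liftB_wordDeriv_apply_coord (hUt (α k)) k', ← Real.norm_eq_abs]
      exact (PiLp.norm_apply_le _ k').trans (hCv _ _ t ht x)
    have h0a : 0 ≤ Cv (α k) ((splits w).get m).1 := (abs_nonneg _).trans ha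
    exact mul_le_mul ha (hCv _ _ t ht x) (norm_nonneg _) h0a
  have b3 : ‖wordDeriv w c x‖ ≤ CF := by
    rw [hc]
    by_cases hj0 : j = 0
    · simp only [hj0, if_true]
      exact hCF x
    · simp only [hj0, if_false]
      rw [wordDeriv_zero]
      simpa using hCF0
  have b4 : ‖wordDeriv w (((timeDerivWithin (Ici 0))^[j + 1] u) t) x‖ ≤ Cv (j + 1) w := hCv _ _ t ht x
  calc ‖ν • wordDeriv w L x - wordDeriv w N x + wordDeriv w c x - wordDeriv w (((timeDerivWithin (Ici 0))^[j + 1] u) t) x‖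
      ≤ ‖ν • wordDeriv w L x‖ + ‖wordDeriv w N x‖ + ‖wordDeriv w c x‖ +
          ‖wordDeriv w (((timeDerivWithin (Ici 0))^[j + 1] u) t) x‖ := by
        refine (norm_sub_le _ _).trans (add_le_add ?_ le_rfl)
        exact (norm_add_le _ _).trans (add_le_add (norm_sub_le _ _) le_rfl)
    _ ≤ _ := by gcongr

/-- Part C, anchor (the registered helper signature): **every `∂^w ∂ₜʲ u` of a forward classical
solution with all-order Sobolev bounds is bounded on `[0, ∞) × T³`.** -/
theorem liftB_partC_anchor :
    ∀ (ν : ℝ) (F : UnitAddTorus (Fin 3) → EuclideanSpace ℝ (Fin 3))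
      (u : ℝ → UnitAddTorus (Fin 3) → EuclideanSpace ℝ (Fin 3)) (p : ℝ → UnitAddTorus (Fin 3) → ℝ),
      IsClassicalNSSolutionOn (Set.Ici 0) ν (fun _ => F) u p → IsSmooth F →
      (∀ k : ℕ, ∃ C : ℝ, ∀ t : ℝ, 0 ≤ t → sobolevEnergy k (u t) ≤ C) →
      ∀ (j : ℕ) (w : List (Fin 3)), ∃ C : ℝ, ∀ t ∈ Set.Ici (0 : ℝ), ∀ x : UnitAddTorus (Fin 3),
        ‖wordDeriv w (((timeDerivWithin (Ici 0))^[j] u) t) x‖ ≤ C :=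
  fun _ _ _ _ hsol hF h0 j w => liftB_sup_words_velocity hsol hF h0 j w

end Summit.AnomalousDissipation.AnomalousDissipation.Theorems.ChainRealisation.SeparatrixFluxPinning

end
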